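import Mathlib
import Summits.Parity.BatemanHorn.Theorems.IsogenyRedeiTypeIMainTermExactIdentity
import HarnessLib

/-!
# Type-I main term for Bateman–Horn (stmt-Parity-0873), input B3 (part 3):
# `ℓ¹`-bounds for `ψ_i`, `𝒶`, `𝓮` at prime powers

With `γ` a common bound for the densities `g_i(p) = rootDensity (f i) p` at the prime `p`
(`0 ≤ g_i(p) ≤ γ ≤ 1`):

* `norm1_psiFun_prime_pow_le` — `‖ψ_i(p^v)‖ ≤ γ^v (1 + v log p)`;
* `norm1_prod_psiFun_prime_pow_le` — `‖(∏ ψ_i)(p^w)‖ ≤ (w+1)^k (1 + w log p)^k γ^w`;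
* `norm1_aFun_prime_pow_le` — `‖𝒶(p^j)‖ ≤ (j+1)^k (1 + j log p)^k`, `norm1_aFun_prime_le` —
  `‖𝒶(p)‖ ≤ k γ (1 + log p)`;
* `norm1_eFun_prime_pow_le` (all primes) — `‖𝓮(p^v)‖ ≤ (k+1)(v+1)^{2k}(1 + v log p)^{2k} γ^{v-k}`;
* `norm1_eFun_prime_pow_le_of_good` (good primes, `v ≥ 1`) —
  `‖𝓮(p^v)‖ ≤ (k+1)(v+1)^k (1 + v log p)^{k+1} γ^v`.

Everything here is proved.
-/

noncomputable section

open Finset Polynomial ArithmeticFunction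
open scoped ArithmeticFunction.Moebius

namespace Summit.Parity.BatemanHorn.Theorems.TypeIMainTerm

open Literature.NumberTheory.Sieve

variable {k : ℕ} (f : Fin k → ℤ[X])

/-! ### `ψ_i` and `∏ ψ_i` -/

/-- `‖ψ_i(p^v)‖₁ ≤ γ^v (1 + v log p)` when `g_i(p) ≤ γ`. -/
theorem norm1_psiFun_prime_pow_le (i : Fin k) {p : ℕ} (hp : p.Prime) {γ : ℝ}
    (hγ : rootDensity (f i) p ≤ γ) (v : ℕ) :
    SAlg.norm1 (psiFun f i (p ^ v)) ≤ γ ^ v * (1 + v * Real.log p) := by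
  have hg0 : 0 ≤ rootDensity (f i) p := rootDensity_nonneg _ _
  have hlog : 0 ≤ Real.log p := Real.log_nonneg (by exact_mod_cast hp.one_lt.le)
  rw [psiFun_prime_pow f i hp, SAlg.norm1_smul, abs_of_nonneg (pow_nonneg hg0 _)]
  refine mul_le_mul (pow_le_pow_left₀ hg0 hγ v) ((SAlg.norm1_lin_le _ _ _).trans ?_)
    (SAlg.norm1_nonneg _) (pow_nonneg (hg0.trans hγ) _)
  rw [abs_one, abs_of_nonneg (by positivity)]

/-- `‖(∏_i ψ_i)(p^w)‖ ≤ (w+1)^k (1 + w log p)^k γ^w`. -/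
theorem norm1_prod_psiFun_prime_pow_le {p : ℕ} (hp : p.Prime) {γ : ℝ} (hγ0 : 0 ≤ γ)
    (hγ : ∀ i, rootDensity (f i) p ≤ γ) (w : ℕ) :
    SAlg.norm1 ((∏ i, psiFun f i) (p ^ w)) ≤
      ((w : ℝ) + 1) ^ k * ((1 + w * Real.log p) ^ k * γ ^ w) := by
  have hlog : 0 ≤ Real.log p := Real.log_nonneg (by exact_mod_cast hp.one_lt.le)
  rw [ArithmeticFunction.prod_apply_eq_sum_finMulAntidiag]
  refine (SAlg.norm1_sum_le _ _).trans ?_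
  have hterm : ∀ d ∈ Nat.finMulAntidiag k (p ^ w),
      SAlg.norm1 (∏ i, psiFun f i (d i)) ≤ (1 + w * Real.log p) ^ k * γ ^ w := by
    intro d hd
    obtain ⟨v, hdv, hvw, hsum⟩ := exists_pow_eq_of_mem_finMulAntidiag hp hd
    refine (SAlg.norm1_prod_le _ _).trans ?_
    calc ∏ i, SAlg.norm1 (psiFun f i (d i)) ≤ ∏ i : Fin k, (γ ^ v i * (1 + w * Real.log p)) := by
          refine Finset.prod_le_prod (fun i _ => SAlg.norm1_nonneg _) fun i _ => ?_
          rw [hdv i]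
          refine (norm1_psiFun_prime_pow_le f i hp (hγ i) (v i)).trans ?_
          refine mul_le_mul_of_nonneg_left ?_ (pow_nonneg hγ0 _)
          have : (v i : ℝ) ≤ w := by exact_mod_cast hvw i
          nlinarith
      _ = (1 + w * Real.log p) ^ k * γ ^ w := by
          rw [Finset.prod_mul_distrib, Finset.prod_pow_eq_pow_sum, hsum, Finset.prod_const,
            Finset.card_univ, Fintype.card_fin, mul_comm]
  refine (Finset.sum_le_sum hterm).trans ?_
  rw [Finset.sum_const, nsmul_eq_mul]
  refine mul_le_mul_of_nonneg_right ?_ (by positivity)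
  exact_mod_cast card_finMulAntidiag_prime_pow_le hp w

/-! ### `𝒶` -/

/-- `SAlg.norm1 (moebLin i n : SAlg k) ≤ 1 + |Real.log n|`. -/
theorem norm1_moebLin_le (i : Fin k) (n : ℕ) :
    SAlg.norm1 (moebLin i n : SAlg k) ≤ 1 + |Real.log n| := by
  unfold moebLin
  refine (SAlg.norm1_lin_le _ _ _).trans ?_
  have h1 : |(μ n : ℝ)| ≤ 1 := by exact_mod_cast ArithmeticFunction.abs_moebius_le_one
  rw [abs_mul]
  nlinarith [abs_nonneg (Real.log n), abs_nonneg (μ n : ℝ)]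

/-- `‖𝒶(p^j)‖ ≤ (j+1)^k (1 + j log p)^k`. -/
theorem norm1_aFun_prime_pow_le {p : ℕ} (hp : p.Prime) (j : ℕ) :
    SAlg.norm1 (aFun f (p ^ j)) ≤ ((j : ℝ) + 1) ^ k * (1 + j * Real.log p) ^ k := by
  have hlog : 0 ≤ Real.log p := Real.log_nonneg (by exact_mod_cast hp.one_lt.le)
  rw [aFun_apply]
  refine (SAlg.norm1_sum_le _ _).trans ?_
  have hterm : ∀ d ∈ Nat.finMulAntidiag k (p ^ j),
      SAlg.norm1 (cWeight f d) ≤ (1 + j * Real.log p) ^ k := by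
    intro d hd
    obtain ⟨v, hdv, hvw, -⟩ := exists_pow_eq_of_mem_finMulAntidiag hp hd
    unfold cWeight
    rw [SAlg.norm1_smul, abs_of_nonneg (sysDensity_nonneg f d)]
    calc sysDensity f d * SAlg.norm1 (∏ i, moebLin i (d i))
        ≤ 1 * ∏ i : Fin k, (1 + j * Real.log p) := by
          refine mul_le_mul (sysDensity_le_one f d) ((SAlg.norm1_prod_le _ _).trans
            (Finset.prod_le_prod (fun i _ => SAlg.norm1_nonneg _) fun i _ => ?_))
            (SAlg.norm1_nonneg _) zero_le_one
          refine (norm1_moebLin_le i (d i)).trans ?_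
          rw [hdv i, Nat.cast_pow, Real.log_pow, abs_of_nonneg (by positivity)]
          have : (v i : ℝ) ≤ j := by exact_mod_cast hvw i
          nlinarith
      _ = (1 + j * Real.log p) ^ k := by
          rw [one_mul, Finset.prod_const, Finset.card_univ, Fintype.card_fin]
  refine (Finset.sum_le_sum hterm).trans ?_
  rw [Finset.sum_const, nsmul_eq_mul]
  refine mul_le_mul_of_nonneg_right ?_ (by positivity)
  exact_mod_cast card_finMulAntidiag_prime_pow_le hp j

/-- `‖𝒶(p)‖ ≤ k γ (1 + log p)`. -/
theorem norm1_aFun_prime_le {p : ℕ} (hp : p.Prime) {γ : ℝ}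
    (hγ : ∀ i, rootDensity (f i) p ≤ γ) :
    SAlg.norm1 (aFun f p) ≤ k * (γ * (1 + Real.log p)) := by
  have hlog : 0 ≤ Real.log p := Real.log_nonneg (by exact_mod_cast hp.one_lt.le)
  rw [aFun_prime f hp, SAlg.norm1_neg]
  refine (SAlg.norm1_sum_le _ _).trans ?_
  calc ∑ i, SAlg.norm1 (psiFun f i p) ≤ ∑ _i : Fin k, γ * (1 + Real.log p) := by
        refine Finset.sum_le_sum fun i _ => ?_
        have := norm1_psiFun_prime_pow_le f i hp (hγ i) 1
        rw [pow_one, pow_one, Nat.cast_one, one_mul] at this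
        exact this
    _ = k * (γ * (1 + Real.log p)) := by
        rw [Finset.sum_const, Finset.card_univ, Fintype.card_fin, nsmul_eq_mul]

/-! ### `𝓮` at prime powers -/

/-- The divisor expansion of `𝓮(p^v)` with the terms `j > k` dropped. -/
theorem eFun_prime_pow_eq_sum {p : ℕ} (hp : p.Prime) (v : ℕ) :
    eFun f (p ^ v) = ∑ j ∈ (Finset.range (v + 1)).filter (· ≤ k),
      aFun f (p ^ j) * (∏ i, psiFun f i) (p ^ (v - j)) := by
  rw [eFun, mul_apply_prime_pow _ _ hp, Finset.sum_filter]
  refine Finset.sum_congr rfl fun j _ => ?_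
  split_ifs with h
  · rfl
  · rw [aFun_prime_pow_eq_zero_of_lt f hp (not_le.mp h), zero_mul]

/-- **`‖𝓮(p^v)‖ ≤ (k+1)(v+1)^{2k}(1 + v log p)^{2k} γ^{v−k}`** at every prime (`γ ≤ 1`). -/
theorem norm1_eFun_prime_pow_le {p : ℕ} (hp : p.Prime) {γ : ℝ} (hγ0 : 0 ≤ γ) (hγ1 : γ ≤ 1)
    (hγ : ∀ i, rootDensity (f i) p ≤ γ) (v : ℕ) :
    SAlg.norm1 (eFun f (p ^ v)) ≤
      ((k : ℝ) + 1) * (((v : ℝ) + 1) ^ (2 * k) * (1 + v * Real.log p) ^ (2 * k) * γ ^ (v - k)) := by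
  have hlog : 0 ≤ Real.log p := Real.log_nonneg (by exact_mod_cast hp.one_lt.le)
  rw [eFun_prime_pow_eq_sum f hp v]
  refine (SAlg.norm1_sum_le _ _).trans ?_
  set Q : ℝ := ((v : ℝ) + 1) ^ (2 * k) * (1 + v * Real.log p) ^ (2 * k) * γ ^ (v - k) with hQ
  have hterm : ∀ j ∈ (Finset.range (v + 1)).filter (· ≤ k),
      SAlg.norm1 (aFun f (p ^ j) * (∏ i, psiFun f i) (p ^ (v - j))) ≤ Q := by
    intro j hj
    rw [Finset.mem_filter, Finset.mem_range] at hj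
    obtain ⟨hjv, hjk⟩ := hj
    have hjv' : j ≤ v := by omega
    refine (SAlg.norm1_mul_le _ _).trans ?_
    have h1 := norm1_aFun_prime_pow_le f hp j
    have h2 := norm1_prod_psiFun_prime_pow_le f hp hγ0 hγ (v - j)
    have hjr : (j : ℝ) ≤ v := by exact_mod_cast hjv'
    have hvjr : ((v - j : ℕ) : ℝ) ≤ v := by exact_mod_cast Nat.sub_le v j
    -- compare each factor with the corresponding factor of `Q`
    have a1 : ((j : ℝ) + 1) ^ k ≤ ((v : ℝ) + 1) ^ k := pow_le_pow_left₀ (by positivity) (by linarith) k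
    have a2 : (1 + j * Real.log p) ^ k ≤ (1 + v * Real.log p) ^ k :=
      pow_le_pow_left₀ (by positivity) (by nlinarith) k
    have a3 : (((v - j : ℕ) : ℝ) + 1) ^ k ≤ ((v : ℝ) + 1) ^ k :=
      pow_le_pow_left₀ (by positivity) (by linarith) k
    have a4 : (1 + ((v - j : ℕ) : ℝ) * Real.log p) ^ k ≤ (1 + v * Real.log p) ^ k :=
      pow_le_pow_left₀ (by positivity) (by nlinarith) k
    have a5 : γ ^ (v - j) ≤ γ ^ (v - k) := pow_le_pow_of_le_one hγ0 hγ1 (by omega)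
    calc SAlg.norm1 (aFun f (p ^ j)) * SAlg.norm1 ((∏ i, psiFun f i) (p ^ (v - j)))
        ≤ (((j : ℝ) + 1) ^ k * (1 + j * Real.log p) ^ k) *
            ((((v - j : ℕ) : ℝ) + 1) ^ k * ((1 + ((v - j : ℕ) : ℝ) * Real.log p) ^ k * γ ^ (v - j))) :=
          mul_le_mul h1 h2 (SAlg.norm1_nonneg _) (by positivity)
      _ ≤ (((v : ℝ) + 1) ^ k * (1 + v * Real.log p) ^ k) *
            (((v : ℝ) + 1) ^ k * ((1 + v * Real.log p) ^ k * γ ^ (v - k))) := by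
          gcongr
      _ = Q := by rw [hQ]; ring
  refine (Finset.sum_le_sum hterm).trans ?_
  rw [Finset.sum_const, nsmul_eq_mul]
  refine mul_le_mul_of_nonneg_right ?_ (by positivity)
  have : ((Finset.range (v + 1)).filter (· ≤ k)).card ≤ k + 1 :=
    calc ((Finset.range (v + 1)).filter (· ≤ k)).card ≤ (Finset.range (k + 1)).card :=
          Finset.card_le_card fun j hj => by
            rw [Finset.mem_filter] at hj; exact Finset.mem_range.mpr (by omega)
      _ = k + 1 := Finset.card_range _
  exact_mod_cast this

/-- **At a good prime and `v ≥ 1`: `‖𝓮(p^v)‖ ≤ (k+1)(v+1)^k (1 + v log p)^{k+1} γ^v`.** -/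
theorem norm1_eFun_prime_pow_le_of_good {p : ℕ} (hp : p.Prime)
    (hgood : ∀ i i' : Fin k, i ≠ i' → ∀ n : ℕ,
      ¬(((p : ℕ) : ℤ) ∣ (f i).eval (n : ℤ) ∧ ((p : ℕ) : ℤ) ∣ (f i').eval (n : ℤ)))
    {γ : ℝ} (hγ0 : 0 ≤ γ) (hγ : ∀ i, rootDensity (f i) p ≤ γ) {v : ℕ} (hv : 1 ≤ v) :
    SAlg.norm1 (eFun f (p ^ v)) ≤
      ((k : ℝ) + 1) * (((v : ℝ) + 1) ^ k * (1 + v * Real.log p) ^ (k + 1) * γ ^ v) := by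
  have hlog : 0 ≤ Real.log p := Real.log_nonneg (by exact_mod_cast hp.one_lt.le)
  -- only `j = 0, 1` survive
  have hexp : eFun f (p ^ v) = (∏ i, psiFun f i) (p ^ v) + aFun f p * (∏ i, psiFun f i) (p ^ (v - 1)) := by
    rw [eFun, mul_apply_prime_pow _ _ hp]
    have hsplit : ∑ j ∈ Finset.range (v + 1), aFun f (p ^ j) * (∏ i, psiFun f i) (p ^ (v - j)) =
        ∑ j ∈ Finset.range 2, aFun f (p ^ j) * (∏ i, psiFun f i) (p ^ (v - j)) := by
      symm
      refine Finset.sum_subset (Finset.range_subset_range.mpr (by omega)) fun j hj hj2 => ?_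
      rw [Finset.mem_range, not_lt] at hj2
      rw [aFun_prime_pow_eq_zero_of_good f hp hgood hj2, zero_mul]
    rw [hsplit, Finset.sum_range_succ, Finset.sum_range_one, pow_zero, Nat.sub_zero,
      (isMultiplicative_aFun f).map_one, one_mul, pow_one]
  rw [hexp]
  refine (SAlg.norm1_add_le _ _).trans ?_
  have h1 := norm1_prod_psiFun_prime_pow_le f hp hγ0 hγ v
  have h2 := norm1_aFun_prime_le f hp hγ
  have h3 := norm1_prod_psiFun_prime_pow_le f hp hγ0 hγ (v - 1)
  have hvr : ((v - 1 : ℕ) : ℝ) ≤ v := by exact_mod_cast Nat.sub_le v 1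
  have hv1 : (1 : ℝ) ≤ v := by exact_mod_cast hv
  have b1 : (((v - 1 : ℕ) : ℝ) + 1) ^ k ≤ ((v : ℝ) + 1) ^ k :=
    pow_le_pow_left₀ (by positivity) (by linarith) k
  have b2 : (1 + ((v - 1 : ℕ) : ℝ) * Real.log p) ^ k ≤ (1 + v * Real.log p) ^ k :=
    pow_le_pow_left₀ (by positivity) (by nlinarith) k
  have b3 : 1 + Real.log p ≤ 1 + v * Real.log p := by nlinarith
  have hkpow : (1 + v * Real.log p) ^ k ≤ (1 + v * Real.log p) ^ (k + 1) := by
    rw [pow_succ]; exact le_mul_of_one_le_right (by positivity) (by nlinarith)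
  have hγv : γ * γ ^ (v - 1) = γ ^ v := by
    rw [← pow_succ', Nat.sub_add_cancel hv]
  calc SAlg.norm1 ((∏ i, psiFun f i) (p ^ v)) + SAlg.norm1 (aFun f p * (∏ i, psiFun f i) (p ^ (v - 1)))
      ≤ ((v : ℝ) + 1) ^ k * ((1 + v * Real.log p) ^ k * γ ^ v) +
          (k * (γ * (1 + Real.log p))) *
            ((((v - 1 : ℕ) : ℝ) + 1) ^ k * ((1 + ((v - 1 : ℕ) : ℝ) * Real.log p) ^ k * γ ^ (v - 1))) :=
        add_le_add h1 ((SAlg.norm1_mul_le _ _).trans (mul_le_mul h2 h3 (SAlg.norm1_nonneg _) (by positivity)))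
    _ ≤ ((v : ℝ) + 1) ^ k * ((1 + v * Real.log p) ^ (k + 1) * γ ^ v) +
          (k * ((1 + v * Real.log p))) *
            (((v : ℝ) + 1) ^ k * ((1 + v * Real.log p) ^ k * (γ * γ ^ (v - 1)))) := by
        have e : (k * (γ * (1 + Real.log p))) *
            ((((v - 1 : ℕ) : ℝ) + 1) ^ k * ((1 + ((v - 1 : ℕ) : ℝ) * Real.log p) ^ k * γ ^ (v - 1))) =
            (k * (1 + Real.log p)) *
            ((((v - 1 : ℕ) : ℝ) + 1) ^ k * ((1 + ((v - 1 : ℕ) : ℝ) * Real.log p) ^ k * (γ * γ ^ (v - 1)))) := by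
          ring
        rw [e]
        gcongr
    _ = ((k : ℝ) + 1) * (((v : ℝ) + 1) ^ k * (1 + v * Real.log p) ^ (k + 1) * γ ^ v) := by
        rw [hγv]; ring

end Summit.Parity.BatemanHorn.Theorems.TypeIMainTerm

end
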